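import Mathlib
import Literature.MathematicalPhysics.QuantumFieldTheory.Balaban1983to89.B11Eq174Chart
import Literature.MathematicalPhysics.QuantumFieldTheory.Balaban1983to89.B12LinearizAnalytic267

/-!
# `Balaban1983to89.B11Claim309UAnalytic` — T. Bałaban, *The variational problem and background fields in renormalization group method
# for lattice gauge theories*, Commun. Math. Phys. **102** (1985) 277–309 [Balaban1985Variational], the paragraph of p. 309 before
# Proposition 9 (SKELETON row **B11.Claim@309**) and the clause of **Proposition 9** *«The function 𝓗(B) … is an analytic function of B,
# and also of the external gauge field configuration U»*: PROVED at the level of the Sect. E–G contraction scheme (`B11Prop6Scheme.mapT`,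
# `B11Eq174Chart.solA` / `chartH`): when the data `𝔊`, `Λ`, `W = (δ/δA′)V`, `J`, `𝔄` of the equation (116)/(175)/(180) depend
# ANALYTICALLY on a parameter (the external configuration `U`, the block field `B`, or both), the selected solution `𝒜` and the
# chart `𝓗` depend analytically on it — through a general [folklore] lemma «the fixed point of a uniformly contracting analytic family is
# analytic in the parameter» proved here by the complex-analytic implicit function theorem

statement-level skeleton of published theorems with citation tags; proofs where landed; nothing here is a claim about the Yang–Mills mass gap

PDF held: `paper:balaban1985-cmp102-variational-background` (journal page = PDF page + 276); pp. 295–296 [PDF 19–20], 305–309 [PDF 29–33]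
read by this seat from the `lit read` text layer (2026-08-21); displays (116)–(121), (174)–(175), (179)–(180) as transcribed in
`B11Prop6Scheme` / `B11Eq174Chart`.

CITATION HEADER (lean-in-tree rule 2026-08-18).  WHAT IS REPRODUCED: SKELETON rows (reader r08 `ROWS-B11.md`) **B11.Claim@309** (so far
`typed-existing (carrier; by-assertion step, cell row G-B11-G3)`, decl of record `B11.AnData.HAnalytic`) = p. 309 [PDF 33], verbatim:
*«These functions and operators can be extended to arbitrary, regular configurations U, precise definitions are given in [4–6]. They are
analytic functions of these configurations, having the properties and bounds as described above, and the equations determine an analytic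
function 𝓗. All the above considerations and properties are valid for this function also.»*; **B11.Prop9** (decl of record
`B11.Prop9Printed`), the clause *«The function 𝓗(B) is determined by Eqs. (174), (175), or (179), (180). It is an analytic function of B,
and also of the external gauge field configuration U satisfying the regularity conditions (3.35)–(3.38) [5], or (1.7)–(1.9) [6].»*; and the
REASON print gives for such analyticity, p. 296 [PDF 20] (proof of Proposition 6): *«the analyticity follows from the fact that the
solution can be constructed as a uniform limit of a sequence of successive approximations. The analyticity of these approximations follows
from the analyticity of δ/δA′V(A′) as a function of A′.»*  Context: `𝒜 = solA 𝒢 Λ W J ε₄ 𝔄` is the solution of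
`X = −𝒢J + Λ(X + 𝔄) − 𝒢(W(X + 𝔄))` ((116) p. 295 / (143) p. 300 / (175) p. 305 / (180) p. 306) in the ball `‖X‖ ≤ ε₄` of (115) under a
`B11Eq174Chart.Regime` ((117)–(121)); `𝓗 = chartH … = T(𝒜 + 𝔄)` ((174)/(179)) with `T` the map (47) of Sect. C.  The tree has the
analyticity IN `𝔄` along complex lines (`B11Prop6Scheme.solution_analytic`, `B11Eq174Chart.Regime.solA_differentiableOn` — uniform limits
of holomorphic iterates, one complex variable) and, for the Sect. C function `D`, the U₀-dependence (`B11Rem287U0Analytic`, gen 9).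

WHAT IS CERTIFIED (kernel, sorry-free; axioms `propext` / `Classical.choice` / `Quot.sound`).
* §1 [folklore] **ANALYTIC DEPENDENCE OF A CONTRACTING FIXED POINT ON A PARAMETER** over complex Banach spaces `E` (parameters), `𝒳`:
  for a family `T : E → 𝒳 → 𝒳` which on an open `S ⊆ E` is uniformly `q`-Lipschitz (`q < 1`) on a set `K ⊆ 𝒳` containing the selected
  fixed points `F p` (`T p (F p) = F p`): `norm_fix_sub_fix_le` (`(1 − q)‖F p − F p₀‖ ≤ ‖T p (F p₀) − T p₀ (F p₀)‖`), `continuousAt_fix`;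
  and if `(p, X) ↦ T p X` is analytic (`C^ω`) at `(p₀, F p₀)` with `I − D_X T(p₀, F p₀)` invertible (`analyticAt_fix`) — in particular
  when `‖D_X T(p₀, F p₀)‖ < 1` (`analyticAt_fix_of_norm_lt_one`) — then `F` is ANALYTIC at `p₀` (Mathlib `ContDiffAt.implicitFunction` at
  `n = ω` for `Φ(p, X) = X − T p X`, identified with `F` near `p₀` by uniqueness + continuity).  DEVIATION from print's mechanism (uniform
  limits of analytic approximations): the implicit function theorem gives the same conclusion in the Fréchet (joint) sense, which is what a
  Banach-space parameter needs; the one-variable uniform-limit road is the tree's `B13Contraction113.differentiableOn_fixedPoint`.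
* §2 THE SECT. E–G SCHEME WITH PARAMETER-DEPENDENT DATA: families `𝒢 : 𝒰 → (𝒵 →L[ℂ] 𝒴)` («Thm 3.13 of [5]» operator `𝔊`, resp. `G`),
  `Λ : 𝒰 → (𝒴 →L[ℂ] 𝒴)` (the linear term of (143), `0` in (116)/(175)), `W : 𝒰 → 𝒴 → 𝒵` (`(δ/δA′)V`), `J : 𝒰 → 𝒵`, `𝔄 : 𝒰 → 𝒴` (`H₁B`,
  `H₀B`), analytic on an open `𝒪 ⊆ 𝒰` (`W` jointly on `𝒪 ×ˢ {‖Y‖ < a₃}`), with a `Regime (𝒢 u) (Λ u) (W u) B₀ θ C₄ a₃ j a ε₄` at every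
  `u ∈ 𝒪` (UNIFORM constants — print's constants are absolute) and `‖J u‖ ≤ j`, `‖𝔄 u‖ < a`: `contDiffAt_mapT` (the map (116) is jointly
  analytic in `(u, X)`), `hasFDerivAt_mapT` (`D_X = Λ − 𝒢∘DW(X + 𝔄)`), **`norm_fderiv_mapT_lt_one`** (`‖D_X‖ ≤ θ + B₀C₄(‖X₀ + 𝔄‖ + m)²/m <
  θ + 4B₀C₄m < 1`, `m = ε₄ + a` — the contraction constant (120)–(121), by the Cauchy estimate
  `B12LinearizAnalytic267.norm_fderiv_le_of_quad`), **`analyticOnNhd_solA`**: `u ↦ solA (𝒢 u) (Λ u) (W u) (J u) ε₄ (𝔄 u)` IS ANALYTIC ON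
  `𝒪` («the equations determine an analytic function»), `continuousAt_solA`.
* §3 THE CHART: with the Sect. C map `Tm : 𝒰 → 𝒴 → 𝒴` ((47), `A′ ↦ A′ − HD(A′)`, parameter-dependent through `H(U)`, `D(U, ·)` —
  `B11Rem287U0Analytic`) jointly analytic on `𝒪 ×ˢ {‖Y‖ < ε₄ + a}`: **`analyticOnNhd_chartH`** — `u ↦ chartH (𝒢 u) (Λ u) (W u) (J u) (Tm u)
  ε₄ (𝔄 u)` = 𝓗 is analytic on `𝒪` (*«the equations determine an analytic function 𝓗»*; with `𝒰 := (U-space) × (B-space)` and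
  `𝔄 (U, B) = H₁(U)B` this is Proposition 9's *«analytic function of B, and also of the external gauge field configuration U»*:
  `analyticOnNhd_chartH_pair`).

MODEL / DECLARED READINGS.  (M1) «analytic function of U»: the regular configurations U of [5] (3.35)–(3.38) / [6] (1.7)–(1.9) (complexified)
form an open subset of a finite-dimensional complex space on the finite lattice; typed as an open set `𝒪` of a complex Banach space `𝒰`, as in
`B11Rem287U0Analytic` (M1).  (M2) The printed premise «They [the functions and operators 𝔊, H, H₀, H₁, D, W, J …] are analytic functions of
these configurations, having the properties and bounds as described above» is EXACTLY the list of hypotheses of §2–§3: analyticity letters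
for each datum + a uniform `Regime`; this file proves the printed CONCLUSION («the equations determine an analytic function 𝓗 … analytic …
also of U») from that premise.  (M3) Joint analyticity in several parameters is the one-parameter statement over a product space (§3,
`analyticOnNhd_chartH_pair`).  (M4) Completeness of `𝒰`, `𝒴`, `𝒵`: automatic on the finite lattice.

HONEST SCOPE — what is NOT claimed.  The premise itself — that `𝔊(U)`, `H₁(U)`, `(δ/δA′)V(U, ·)`, `J(U)` … ARE analytic in U with uniform
bounds ([4] Sect. 5, [5] Sect. E, [6]) — stays a hypothesis, as print takes it from [4–6]; the first sentence of the paragraph («can be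
extended to arbitrary, regular configurations U») is a statement about those papers' objects and is not typed; no lattice object is
constructed; the (190) clause of Proposition 9 is untouched (`B11SectG`, `B11Ineq189`).  No new named fact: every declaration is a
theorem over hypothesis binders.  Mega-formalization `lit-balaban`, HOME `run/shared/lean/pub/lit-balaban/`, reader/typer seat r08 gen 9
(unit `lit-balaban-r08`, B11 fold owner).  Imports `B11Eq174Chart` (hence `B11Prop6Scheme`, `B13Contraction113`) and `B12LinearizAnalytic267`
(Cauchy estimate for the Fréchet derivative, Neumann invertibility); modifies nothing there.
-/

namespace Literature.MathematicalPhysics.QuantumFieldTheory.Balaban1983to89.B11Claim309UAnalytic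

open Metric Set Filter Topology
open scoped ContDiff
open Literature.MathematicalPhysics.QuantumFieldTheory.Balaban1983to89
open B11Prop6Scheme B11Eq174Chart B12LinearizAnalytic267

/-! ## §1 [folklore] Analytic dependence of a contracting fixed point on a parameter -/

section Fix

variable {E 𝒳 : Type*} [NormedAddCommGroup E] [NormedSpace ℂ E] [NormedAddCommGroup 𝒳] [NormedSpace ℂ 𝒳]
  {S : Set E} {K : Set 𝒳} {T : E → 𝒳 → 𝒳} {F : E → 𝒳} {q : ℝ}

omit [NormedAddCommGroup E] [NormedSpace ℂ E] [NormedSpace ℂ 𝒳] in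
/-- **Stability of contracting fixed points**: `(1 − q)‖F p − F p₀‖ ≤ ‖T p (F p₀) − T p₀ (F p₀)‖` — the two maps compared at the second fixed
point (print's successive approximations start this way). [cite: Balaban1985Variational, (119)-(121) p.295, p.296] -/
theorem norm_fix_sub_fix_le (hfix : ∀ p ∈ S, F p ∈ K ∧ T p (F p) = F p)
    (hlip : ∀ p ∈ S, ∀ x ∈ K, ∀ y ∈ K, ‖T p x - T p y‖ ≤ q * ‖x - y‖) {p p₀ : E} (hp : p ∈ S) (hp₀ : p₀ ∈ S) :
    (1 - q) * ‖F p - F p₀‖ ≤ ‖T p (F p₀) - T p₀ (F p₀)‖ := by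
  have h1 : ‖T p (F p) - T p (F p₀)‖ ≤ q * ‖F p - F p₀‖ := hlip p hp _ (hfix p hp).1 _ (hfix p₀ hp₀).1
  have hsplit : F p - F p₀ = (T p (F p) - T p (F p₀)) + (T p (F p₀) - T p₀ (F p₀)) := by
    rw [(hfix p hp).2, (hfix p₀ hp₀).2]; abel
  have hle : ‖F p - F p₀‖ ≤ q * ‖F p - F p₀‖ + ‖T p (F p₀) - T p₀ (F p₀)‖ := by
    calc ‖F p - F p₀‖ = ‖(T p (F p) - T p (F p₀)) + (T p (F p₀) - T p₀ (F p₀))‖ := by rw [← hsplit]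
      _ ≤ ‖T p (F p) - T p (F p₀)‖ + ‖T p (F p₀) - T p₀ (F p₀)‖ := norm_add_le _ _
      _ ≤ _ := by gcongr
  linarith

omit [NormedSpace ℂ E] [NormedSpace ℂ 𝒳] in
/-- **Continuity of the fixed point in the parameter** (open parameter set, `q < 1`, the comparison map `p ↦ T p (F p₀)` continuous at `p₀`).
[cite: Balaban1985Variational, p.296, p.309] -/
theorem continuousAt_fix (hS : IsOpen S) (hfix : ∀ p ∈ S, F p ∈ K ∧ T p (F p) = F p)
    (hlip : ∀ p ∈ S, ∀ x ∈ K, ∀ y ∈ K, ‖T p x - T p y‖ ≤ q * ‖x - y‖) (hq : q < 1) {p₀ : E} (hp₀ : p₀ ∈ S)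
    (hT : ContinuousAt (fun p : E => T p (F p₀)) p₀) : ContinuousAt F p₀ := by
  have h1q : 0 < 1 - q := sub_pos.mpr hq
  rw [Metric.continuousAt_iff] at hT ⊢
  intro η hη
  obtain ⟨δ₁, hδ₁, hδ₁'⟩ := hT ((1 - q) * η) (by positivity)
  obtain ⟨δ₂, hδ₂, hδ₂'⟩ := Metric.isOpen_iff.mp hS p₀ hp₀
  refine ⟨min δ₁ δ₂, lt_min hδ₁ hδ₂, fun p hp => ?_⟩
  have hpS : p ∈ S := hδ₂' (lt_of_lt_of_le hp (min_le_right _ _))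
  have hd := hδ₁' (lt_of_lt_of_le hp (min_le_left _ _))
  rw [dist_eq_norm] at hd ⊢
  have hkey := norm_fix_sub_fix_le hfix hlip hpS hp₀
  by_contra hcon
  have hcon' : η ≤ ‖F p - F p₀‖ := not_lt.mp hcon
  have : (1 - q) * η ≤ (1 - q) * ‖F p - F p₀‖ := mul_le_mul_of_nonneg_left hcon' h1q.le
  linarith

omit [NormedAddCommGroup E] [NormedSpace ℂ E] in
/-- The `X`-section of `Φ(p, X) = X − T p X` at `p₀` has derivative `I − D_X T(p₀, X)`. [folklore] -/
private theorem hasFDerivAt_fixMap_section {p₀ : E} {X : 𝒳} (hd : DifferentiableAt ℂ (T p₀) X) :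
    HasFDerivAt (fun X' : 𝒳 => X' - T p₀ X') (ContinuousLinearMap.id ℂ 𝒳 - fderiv ℂ (T p₀) X) X :=
  (hasFDerivAt_id X).sub hd.hasFDerivAt

variable [CompleteSpace E] [CompleteSpace 𝒳]

/-- **ANALYTICITY OF THE FIXED POINT IN THE PARAMETER** ([folklore]; the mechanism behind *«the equations determine an analytic function»*,
p. 309, and Prop. 6's analyticity clause p. 296): if `(p, X) ↦ T p X` is `C^ω` at `(p₀, F p₀)` and `I − D_X T(p₀, F p₀)` is invertible, then
the fixed-point selector `F` is analytic at `p₀` — complex-analytic implicit function theorem for `Φ(p, X) = X − T p X`, identified with `F`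
near `p₀` through `continuousAt_fix` and the fixed-point property on the open set `S`. [cite: Balaban1985Variational, p.296, p.309] -/
theorem analyticAt_fix (hS : IsOpen S) (hfix : ∀ p ∈ S, F p ∈ K ∧ T p (F p) = F p)
    (hlip : ∀ p ∈ S, ∀ x ∈ K, ∀ y ∈ K, ‖T p x - T p y‖ ≤ q * ‖x - y‖) (hq : q < 1) {p₀ : E} (hp₀ : p₀ ∈ S)
    (hT : ContDiffAt ℂ ω (fun z : E × 𝒳 => T z.1 z.2) (p₀, F p₀))
    (hinv : (ContinuousLinearMap.id ℂ 𝒳 - fderiv ℂ (T p₀) (F p₀)).IsInvertible) : AnalyticAt ℂ F p₀ := by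
  have hω : (ω : ℕ∞ω) ≠ 0 := by simp
  set Φ : E × 𝒳 → 𝒳 := fun z => z.2 - T z.1 z.2 with hΦ
  have hΦω : ContDiffAt ℂ ω Φ (p₀, F p₀) := contDiffAt_snd.sub hT
  -- the section through `inr`
  have hTsec : DifferentiableAt ℂ (T p₀) (F p₀) := by
    have h1 : DifferentiableAt ℂ (fun z : E × 𝒳 => T z.1 z.2) ((fun X : 𝒳 => (p₀, X)) (F p₀)) := hT.differentiableAt (by simp)
    have h2 : DifferentiableAt ℂ (fun X : 𝒳 => (p₀, X)) (F p₀) := (hasFDerivAt_prodMk_right p₀ (F p₀)).differentiableAt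
    have h3 := h1.comp (F p₀) h2
    simpa [Function.comp_def] using h3
  have hinr : (fderiv ℂ Φ (p₀, F p₀) ∘L ContinuousLinearMap.inr ℂ E 𝒳).IsInvertible := by
    have hΦd : DifferentiableAt ℂ Φ (p₀, F p₀) := hΦω.differentiableAt (by simp)
    have hsec : HasFDerivAt (fun X : 𝒳 => Φ (p₀, X)) (fderiv ℂ Φ (p₀, F p₀) ∘L ContinuousLinearMap.inr ℂ E 𝒳) (F p₀) :=
      hΦd.hasFDerivAt.comp (F p₀) (hasFDerivAt_prodMk_right p₀ (F p₀))
    have hsec' : HasFDerivAt (fun X : 𝒳 => Φ (p₀, X)) (ContinuousLinearMap.id ℂ 𝒳 - fderiv ℂ (T p₀) (F p₀)) (F p₀) :=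
      hasFDerivAt_fixMap_section hTsec
    rw [hsec.unique hsec']
    exact hinv
  -- continuity of the comparison map `p ↦ T p (F p₀)` from the joint analyticity, hence of `F`
  have hcmp : ContinuousAt (fun p : E => T p (F p₀)) p₀ := by
    have h1 : ContinuousAt (fun z : E × 𝒳 => T z.1 z.2) ((fun p : E => (p, F p₀)) p₀) := hT.continuousAt
    have h2 : ContinuousAt (fun p : E => (p, F p₀)) p₀ := continuousAt_id.prodMk continuousAt_const
    exact ContinuousAt.comp_of_eq h1 h2 rfl
  have hcont : ContinuousAt F p₀ := continuousAt_fix hS hfix hlip hq hp₀ hcmp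
  -- identification of Mathlib's implicit function with `F` near `p₀`
  have heq : hΦω.implicitFunction hω hinr =ᶠ[𝓝 p₀] F := by
    have hψ := hΦω.eventually_apply_eq_iff_implicitFunction hω hinr
    have ht : ContinuousAt (fun p : E => (p, F p)) p₀ := continuousAt_id.prodMk hcont
    have h1 : ∀ᶠ p in 𝓝 p₀, Φ (p, F p) = Φ (p₀, F p₀) ↔ hΦω.implicitFunction hω hinr (p, F p).1 = (p, F p).2 :=
      Filter.Tendsto.eventually ht hψ
    filter_upwards [h1, hS.mem_nhds hp₀] with p h hp
    refine h.1 ?_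
    show F p - T p (F p) = F p₀ - T p₀ (F p₀)
    rw [(hfix p hp).2, (hfix p₀ hp₀).2, sub_self, sub_self]
  exact ((hΦω.contDiffAt_implicitFunction hω hinr).analyticAt).congr heq

/-- The same with the invertibility supplied by a derivative bound `‖D_X T(p₀, F p₀)‖ < 1` (Neumann series,
`B12LinearizAnalytic267.isInvertible_id_add_of_norm_le`). [cite: Balaban1985Variational, (121) p.295, p.309] -/
theorem analyticAt_fix_of_norm_lt_one (hS : IsOpen S) (hfix : ∀ p ∈ S, F p ∈ K ∧ T p (F p) = F p)
    (hlip : ∀ p ∈ S, ∀ x ∈ K, ∀ y ∈ K, ‖T p x - T p y‖ ≤ q * ‖x - y‖) (hq : q < 1) {p₀ : E} (hp₀ : p₀ ∈ S)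
    (hT : ContDiffAt ℂ ω (fun z : E × 𝒳 => T z.1 z.2) (p₀, F p₀)) (hlt : ‖fderiv ℂ (T p₀) (F p₀)‖ < 1) :
    AnalyticAt ℂ F p₀ := by
  refine analyticAt_fix hS hfix hlip hq hp₀ hT ?_
  have h := (isInvertible_id_add_of_norm_le (A := -fderiv ℂ (T p₀) (F p₀)) (by rw [norm_neg]) hlt).1
  rwa [← sub_eq_add_neg] at h

end Fix

/-! ## §2 The Sect. E–G scheme with parameter-dependent data -/

section Scheme

variable {𝒰 𝒴 𝒵 : Type*} [NormedAddCommGroup 𝒰] [NormedSpace ℂ 𝒰] [NormedAddCommGroup 𝒴] [NormedSpace ℂ 𝒴]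
  [NormedAddCommGroup 𝒵] [NormedSpace ℂ 𝒵]
  {𝒪 : Set 𝒰} {𝒢 : 𝒰 → (𝒵 →L[ℂ] 𝒴)} {Λ : 𝒰 → (𝒴 →L[ℂ] 𝒴)} {W : 𝒰 → 𝒴 → 𝒵} {J : 𝒰 → 𝒵} {𝔄 : 𝒰 → 𝒴}
  {B₀ θ C₄ a₃ j a ε₄ : ℝ}

omit [NormedAddCommGroup 𝒰] [NormedSpace ℂ 𝒰] in
/-- A section `Y ↦ W(U, Y)` of the jointly analytic `W` is analytic («(δ/δA′)V … analytic», the `Prop4Hyp`/`Regime` letter per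
configuration). [cite: Balaban1985Variational, Prop. 4 p.292, p.309] -/
theorem analyticAt_W_section [NormedAddCommGroup 𝒰] [NormedSpace ℂ 𝒰] {u : 𝒰} {Y : 𝒴}
    (h : AnalyticAt ℂ (fun p : 𝒰 × 𝒴 => W p.1 p.2) (u, Y)) : AnalyticAt ℂ (W u) Y := by
  have h2 : AnalyticAt ℂ (fun Y' : 𝒴 => (u, Y')) Y := analyticAt_const.prod analyticAt_id
  have h3 := AnalyticAt.comp_of_eq h h2 rfl
  simpa [Function.comp_def] using h3

omit [NormedAddCommGroup 𝒰] [NormedSpace ℂ 𝒰] in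
/-- **The derivative of the map (116) in `X`**: `D_X T = Λ − 𝒢∘DW(X + 𝔄)` (at a point where `W` is differentiable).
[cite: Balaban1985Variational, (116) p.295, (119) p.295] -/
theorem hasFDerivAt_mapT {𝒢₀ : 𝒵 →L[ℂ] 𝒴} {Λ₀ : 𝒴 →L[ℂ] 𝒴} {W₀ : 𝒴 → 𝒵} {J₀ : 𝒵} {𝔄₀ X₀ : 𝒴}
    (hW : DifferentiableAt ℂ W₀ (X₀ + 𝔄₀)) :
    HasFDerivAt (mapT 𝒢₀ Λ₀ W₀ J₀ 𝔄₀) (Λ₀ - 𝒢₀ ∘L fderiv ℂ W₀ (X₀ + 𝔄₀)) X₀ := by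
  have h1 : HasFDerivAt (fun X : 𝒴 => X + 𝔄₀) (ContinuousLinearMap.id ℂ 𝒴) X₀ := (hasFDerivAt_id X₀).add_const 𝔄₀
  have h2 : HasFDerivAt (fun X : 𝒴 => Λ₀ (X + 𝔄₀)) (Λ₀ ∘L ContinuousLinearMap.id ℂ 𝒴) X₀ := Λ₀.hasFDerivAt.comp X₀ h1
  have h4 : HasFDerivAt (fun X : 𝒴 => W₀ (X + 𝔄₀)) (fderiv ℂ W₀ (X₀ + 𝔄₀) ∘L ContinuousLinearMap.id ℂ 𝒴) X₀ :=
    hW.hasFDerivAt.comp X₀ h1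
  have h5 : HasFDerivAt (fun X : 𝒴 => 𝒢₀ (W₀ (X + 𝔄₀)))
      (𝒢₀ ∘L (fderiv ℂ W₀ (X₀ + 𝔄₀) ∘L ContinuousLinearMap.id ℂ 𝒴)) X₀ := 𝒢₀.hasFDerivAt.comp X₀ h4
  have h6 := (h2.const_add (-𝒢₀ J₀)).sub h5
  simp only [ContinuousLinearMap.comp_id] at h6
  exact h6

omit [NormedAddCommGroup 𝒰] [NormedSpace ℂ 𝒰] in
/-- **`‖D_X T‖ < 1` at the solution** — the contraction constant of (120)–(121): at `X₀` with `‖X₀‖ ≤ ε₄` (so `‖X₀ + 𝔄‖ < m := ε₄ + a`),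
`‖Λ − 𝒢∘DW(X₀ + 𝔄)‖ ≤ θ + B₀·C₄(‖X₀ + 𝔄‖ + m)²/m < θ + 4B₀C₄m < 1` (Cauchy estimate of radius `m`, the printed *«r = (ε₄ + B₀|B|)(…)⁻¹»*,
inside the ball `2m ≤ a₃` of Proposition 4). [cite: Balaban1985Variational, (119)-(121) p.295] -/
theorem norm_fderiv_mapT_lt_one {𝒢₀ : 𝒵 →L[ℂ] 𝒴} {Λ₀ : 𝒴 →L[ℂ] 𝒴} {W₀ : 𝒴 → 𝒵} {J₀ : 𝒵} {𝔄₀ X₀ : 𝒴}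
    (R : Regime 𝒢₀ Λ₀ W₀ B₀ θ C₄ a₃ j a ε₄) (hWd : DifferentiableOn ℂ W₀ {Y : 𝒴 | ‖Y‖ < a₃})
    (h𝔄 : ‖𝔄₀‖ < a) (hX₀ : ‖X₀‖ ≤ ε₄) :
    ‖fderiv ℂ (mapT 𝒢₀ Λ₀ W₀ J₀ 𝔄₀) X₀‖ < 1 := by
  set m : ℝ := ε₄ + a with hm
  have hY : ‖X₀ + 𝔄₀‖ < m := norm_arg_lt h𝔄 hX₀
  have hmpos : 0 < m := (norm_nonneg _).trans_lt hY
  have hYm : ‖X₀ + 𝔄₀‖ + m < a₃ := by linarith [R.dom]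
  have hD : ‖fderiv ℂ W₀ (X₀ + 𝔄₀)‖ ≤ C₄ * (‖X₀ + 𝔄₀‖ + m) ^ 2 / m :=
    norm_fderiv_le_of_quad hWd R.quad.quad R.C₄_nonneg hmpos hYm
  have hD4 : C₄ * (‖X₀ + 𝔄₀‖ + m) ^ 2 / m < 4 * C₄ * m + (1 - (θ + 4 * B₀ * C₄ * m)) / (B₀ + 1) := by
    have hslack : 0 < (1 - (θ + 4 * B₀ * C₄ * m)) / (B₀ + 1) :=
      div_pos (sub_pos.mpr R.contr) (by linarith [R.B₀_nonneg])
    have hle : C₄ * (‖X₀ + 𝔄₀‖ + m) ^ 2 / m ≤ 4 * C₄ * m := by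
      rw [div_le_iff₀ hmpos]
      have : (‖X₀ + 𝔄₀‖ + m) ^ 2 ≤ (2 * m) ^ 2 := by
        gcongr; linarith
      nlinarith [R.C₄_nonneg]
    linarith
  have hWdiff : DifferentiableAt ℂ W₀ (X₀ + 𝔄₀) :=
    hWd.differentiableAt ((isOpen_lt continuous_norm continuous_const).mem_nhds (by
      show ‖X₀ + 𝔄₀‖ < a₃; linarith))
  rw [(hasFDerivAt_mapT (𝒢₀ := 𝒢₀) (Λ₀ := Λ₀) (J₀ := J₀) hWdiff).fderiv]
  have hΛ : ‖Λ₀‖ ≤ θ := ContinuousLinearMap.opNorm_le_bound _ R.θ_nonneg R.norm_L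
  have h𝒢 : ‖𝒢₀‖ ≤ B₀ := ContinuousLinearMap.opNorm_le_bound _ R.B₀_nonneg R.norm_G
  calc ‖Λ₀ - 𝒢₀ ∘L fderiv ℂ W₀ (X₀ + 𝔄₀)‖ ≤ ‖Λ₀‖ + ‖𝒢₀ ∘L fderiv ℂ W₀ (X₀ + 𝔄₀)‖ := norm_sub_le _ _
    _ ≤ θ + ‖𝒢₀‖ * ‖fderiv ℂ W₀ (X₀ + 𝔄₀)‖ := by
        gcongr; exact ContinuousLinearMap.opNorm_comp_le _ _
    _ ≤ θ + B₀ * (C₄ * (‖X₀ + 𝔄₀‖ + m) ^ 2 / m) := by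
        have := mul_le_mul h𝒢 hD (norm_nonneg _) R.B₀_nonneg
        linarith
    _ < 1 := by
        have hB1 : B₀ * (C₄ * (‖X₀ + 𝔄₀‖ + m) ^ 2 / m) ≤
            B₀ * (4 * C₄ * m + (1 - (θ + 4 * B₀ * C₄ * m)) / (B₀ + 1)) :=
          mul_le_mul_of_nonneg_left hD4.le R.B₀_nonneg
        have hfrac : B₀ * ((1 - (θ + 4 * B₀ * C₄ * m)) / (B₀ + 1)) < 1 - (θ + 4 * B₀ * C₄ * m) := by
          have hpos : 0 < 1 - (θ + 4 * B₀ * C₄ * m) := sub_pos.mpr R.contr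
          have hB : 0 < B₀ + 1 := by linarith [R.B₀_nonneg]
          rw [mul_div_assoc', div_lt_iff₀ hB]
          nlinarith [R.B₀_nonneg]
        nlinarith [R.B₀_nonneg]

variable [CompleteSpace 𝒴] [CompleteSpace 𝒵]

/-- **The map (116) is jointly analytic in the parameter and the unknown** at every `(u, X)` with `u ∈ 𝒪`, `‖X + 𝔄(u)‖ < a₃` — the premise
«They are analytic functions of these configurations» composed: `𝔊(u)`, `Λ(u)`, `J(u)`, `𝔄(u)` analytic in `u`, `W` jointly analytic.
[cite: Balaban1985Variational, (116) p.295, p.309] -/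
theorem contDiffAt_mapT (h𝒢 : AnalyticOnNhd ℂ 𝒢 𝒪) (hΛ : AnalyticOnNhd ℂ Λ 𝒪)
    (hW : AnalyticOnNhd ℂ (fun p : 𝒰 × 𝒴 => W p.1 p.2) (𝒪 ×ˢ {Y : 𝒴 | ‖Y‖ < a₃})) (hJ : AnalyticOnNhd ℂ J 𝒪)
    (h𝔄 : AnalyticOnNhd ℂ 𝔄 𝒪) {u : 𝒰} (hu : u ∈ 𝒪) {X : 𝒴} (hX : ‖X + 𝔄 u‖ < a₃) :
    ContDiffAt ℂ ω (fun z : 𝒰 × 𝒴 => mapT (𝒢 z.1) (Λ z.1) (W z.1) (J z.1) (𝔄 z.1) z.2) (u, X) := by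
  have g𝒢 : ContDiffAt ℂ ω (fun z : 𝒰 × 𝒴 => 𝒢 z.1) (u, X) := (h𝒢 u hu).contDiffAt.comp _ contDiffAt_fst
  have gΛ : ContDiffAt ℂ ω (fun z : 𝒰 × 𝒴 => Λ z.1) (u, X) := (hΛ u hu).contDiffAt.comp _ contDiffAt_fst
  have gJ : ContDiffAt ℂ ω (fun z : 𝒰 × 𝒴 => J z.1) (u, X) := (hJ u hu).contDiffAt.comp _ contDiffAt_fst
  have g𝔄 : ContDiffAt ℂ ω (fun z : 𝒰 × 𝒴 => 𝔄 z.1) (u, X) := (h𝔄 u hu).contDiffAt.comp _ contDiffAt_fst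
  have gA : ContDiffAt ℂ ω (fun z : 𝒰 × 𝒴 => z.2 + 𝔄 z.1) (u, X) := contDiffAt_snd.add g𝔄
  have gin : ContDiffAt ℂ ω (fun z : 𝒰 × 𝒴 => (z.1, z.2 + 𝔄 z.1)) (u, X) := contDiffAt_fst.prodMk gA
  have gWpt : ContDiffAt ℂ ω (fun p : 𝒰 × 𝒴 => W p.1 p.2)
      ((fun z : 𝒰 × 𝒴 => (z.1, z.2 + 𝔄 z.1)) (u, X)) := (hW (u, X + 𝔄 u) ⟨hu, hX⟩).contDiffAt
  have gW : ContDiffAt ℂ ω (fun z : 𝒰 × 𝒴 => W z.1 (z.2 + 𝔄 z.1)) (u, X) := by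
    have h := gWpt.comp (u, X) gin
    simpa [Function.comp_def] using h
  have htot := ((g𝒢.clm_apply gJ).neg.add (gΛ.clm_apply gA)).sub (g𝒢.clm_apply gW)
  have hfun : (fun z : 𝒰 × 𝒴 => mapT (𝒢 z.1) (Λ z.1) (W z.1) (J z.1) (𝔄 z.1) z.2) =
      fun z : 𝒰 × 𝒴 => -(𝒢 z.1) (J z.1) + (Λ z.1) (z.2 + 𝔄 z.1) - (𝒢 z.1) (W z.1 (z.2 + 𝔄 z.1)) := by
    funext z; rfl
  rw [hfun]
  exact htot

variable [CompleteSpace 𝒰]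

/-- **«The equations determine an analytic function»**: under a UNIFORM regime on the open parameter domain `𝒪` and the analyticity
letters for the data, the selected solution `u ↦ 𝒜(u) = solA (𝒢 u) (Λ u) (W u) (J u) ε₄ (𝔄 u)` of (116)/(143)/(175)/(180) is ANALYTIC at
every `u₀ ∈ 𝒪`. [cite: Balaban1985Variational, p.309, Prop. 9 p.309, Prop. 6 p.296] -/
theorem analyticAt_solA (h𝒪 : IsOpen 𝒪) (R : ∀ u ∈ 𝒪, Regime (𝒢 u) (Λ u) (W u) B₀ θ C₄ a₃ j a ε₄)
    (hJb : ∀ u ∈ 𝒪, ‖J u‖ ≤ j) (h𝔄b : ∀ u ∈ 𝒪, ‖𝔄 u‖ < a)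
    (h𝒢 : AnalyticOnNhd ℂ 𝒢 𝒪) (hΛ : AnalyticOnNhd ℂ Λ 𝒪)
    (hW : AnalyticOnNhd ℂ (fun p : 𝒰 × 𝒴 => W p.1 p.2) (𝒪 ×ˢ {Y : 𝒴 | ‖Y‖ < a₃})) (hJ : AnalyticOnNhd ℂ J 𝒪)
    (h𝔄 : AnalyticOnNhd ℂ 𝔄 𝒪) {u₀ : 𝒰} (hu₀ : u₀ ∈ 𝒪) :
    AnalyticAt ℂ (fun u : 𝒰 => solA (𝒢 u) (Λ u) (W u) (J u) ε₄ (𝔄 u)) u₀ := by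
  -- the data of §1: T u = mapT …, F u = solA …, K = the closed ball of (115), q = the contraction constant (121)
  have hfix : ∀ u ∈ 𝒪, solA (𝒢 u) (Λ u) (W u) (J u) ε₄ (𝔄 u) ∈ closedBall (0 : 𝒴) ε₄ ∧
      mapT (𝒢 u) (Λ u) (W u) (J u) (𝔄 u) (solA (𝒢 u) (Λ u) (W u) (J u) ε₄ (𝔄 u)) =
        solA (𝒢 u) (Λ u) (W u) (J u) ε₄ (𝔄 u) := fun u hu => by
    have hm := (R u hu).solA_mem (hJb u hu) (h𝔄b u hu)
    exact ⟨mem_closedBall_zero_iff.mpr hm.1, hm.2⟩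
  have hlip : ∀ u ∈ 𝒪, ∀ x ∈ closedBall (0 : 𝒴) ε₄, ∀ y ∈ closedBall (0 : 𝒴) ε₄,
      ‖mapT (𝒢 u) (Λ u) (W u) (J u) (𝔄 u) x - mapT (𝒢 u) (Λ u) (W u) (J u) (𝔄 u) y‖ ≤
        (θ + 4 * B₀ * C₄ * (ε₄ + a)) * ‖x - y‖ := fun u hu x hx y hy =>
    lipschitz_120 (J := J u) (R u hu).norm_G (R u hu).norm_L (R u hu).quad (R u hu).B₀_nonneg (R u hu).C₄_nonneg
      (h𝔄b u hu) (R u hu).ε₄_nonneg (R u hu).dom (mem_closedBall_zero_iff.mp hx) (mem_closedBall_zero_iff.mp hy)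
  have hq : θ + 4 * B₀ * C₄ * (ε₄ + a) < 1 := (R u₀ hu₀).contr
  -- joint analyticity of the map at the graph point and the derivative bound there
  have hX₀ : ‖solA (𝒢 u₀) (Λ u₀) (W u₀) (J u₀) ε₄ (𝔄 u₀)‖ ≤ ε₄ := mem_closedBall_zero_iff.mp (hfix u₀ hu₀).1
  have harg : ‖solA (𝒢 u₀) (Λ u₀) (W u₀) (J u₀) ε₄ (𝔄 u₀) + 𝔄 u₀‖ < a₃ := by
    have h := norm_arg_lt (h𝔄b u₀ hu₀) hX₀
    linarith [(R u₀ hu₀).dom, (R u₀ hu₀).ε₄_nonneg, (norm_nonneg (𝔄 u₀)).trans_lt (h𝔄b u₀ hu₀)]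
  have hT := contDiffAt_mapT h𝒢 hΛ hW hJ h𝔄 hu₀ harg
  have hWd : DifferentiableOn ℂ (W u₀) {Y : 𝒴 | ‖Y‖ < a₃} := fun Y hY =>
    (analyticAt_W_section (hW (u₀, Y) ⟨hu₀, hY⟩)).differentiableAt.differentiableWithinAt
  have hlt := norm_fderiv_mapT_lt_one (J₀ := J u₀) (R u₀ hu₀) hWd (h𝔄b u₀ hu₀) hX₀
  exact analyticAt_fix_of_norm_lt_one (T := fun u => mapT (𝒢 u) (Λ u) (W u) (J u) (𝔄 u))
    (F := fun u => solA (𝒢 u) (Λ u) (W u) (J u) ε₄ (𝔄 u)) h𝒪 hfix hlip hq hu₀ hT hlt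

/-- **`𝒜` is analytic on the whole parameter domain `𝒪`** («analytic … also of the external gauge field configuration U»).
[cite: Balaban1985Variational, p.309, Prop. 9 p.309] -/
theorem analyticOnNhd_solA (h𝒪 : IsOpen 𝒪) (R : ∀ u ∈ 𝒪, Regime (𝒢 u) (Λ u) (W u) B₀ θ C₄ a₃ j a ε₄)
    (hJb : ∀ u ∈ 𝒪, ‖J u‖ ≤ j) (h𝔄b : ∀ u ∈ 𝒪, ‖𝔄 u‖ < a)
    (h𝒢 : AnalyticOnNhd ℂ 𝒢 𝒪) (hΛ : AnalyticOnNhd ℂ Λ 𝒪)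
    (hW : AnalyticOnNhd ℂ (fun p : 𝒰 × 𝒴 => W p.1 p.2) (𝒪 ×ˢ {Y : 𝒴 | ‖Y‖ < a₃})) (hJ : AnalyticOnNhd ℂ J 𝒪)
    (h𝔄 : AnalyticOnNhd ℂ 𝔄 𝒪) :
    AnalyticOnNhd ℂ (fun u : 𝒰 => solA (𝒢 u) (Λ u) (W u) (J u) ε₄ (𝔄 u)) 𝒪 := fun _ hu =>
  analyticAt_solA h𝒪 R hJb h𝔄b h𝒢 hΛ hW hJ h𝔄 hu

/-- Continuity of `u ↦ 𝒜(u)` on `𝒪` (a corollary; the quantitative form is §1's `norm_fix_sub_fix_le` with `q = θ + 4B₀C₄(ε₄ + a)`).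
[cite: Balaban1985Variational, p.309] -/
theorem continuousAt_solA (h𝒪 : IsOpen 𝒪) (R : ∀ u ∈ 𝒪, Regime (𝒢 u) (Λ u) (W u) B₀ θ C₄ a₃ j a ε₄)
    (hJb : ∀ u ∈ 𝒪, ‖J u‖ ≤ j) (h𝔄b : ∀ u ∈ 𝒪, ‖𝔄 u‖ < a)
    (h𝒢 : AnalyticOnNhd ℂ 𝒢 𝒪) (hΛ : AnalyticOnNhd ℂ Λ 𝒪)
    (hW : AnalyticOnNhd ℂ (fun p : 𝒰 × 𝒴 => W p.1 p.2) (𝒪 ×ˢ {Y : 𝒴 | ‖Y‖ < a₃})) (hJ : AnalyticOnNhd ℂ J 𝒪)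
    (h𝔄 : AnalyticOnNhd ℂ 𝔄 𝒪) {u₀ : 𝒰} (hu₀ : u₀ ∈ 𝒪) :
    ContinuousAt (fun u : 𝒰 => solA (𝒢 u) (Λ u) (W u) (J u) ε₄ (𝔄 u)) u₀ :=
  (analyticAt_solA h𝒪 R hJb h𝔄b h𝒢 hΛ hW hJ h𝔄 hu₀).continuousAt

/-! ## §3 The chart 𝓗 -/

/-- **«the equations determine an analytic function 𝓗»**: with the Sect. C map `Tm u` ((47), parameter-dependent) jointly analytic on
`𝒪 ×ˢ {‖Y‖ < ε₄ + a}` (the range of `𝒜(u) + 𝔄(u)`), the chart `u ↦ chartH (𝒢 u) (Λ u) (W u) (J u) (Tm u) ε₄ (𝔄 u) = Tm u (𝒜(u) + 𝔄(u))`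
((174)/(179)) is analytic on `𝒪`. [cite: Balaban1985Variational, (174) p.305, (179) p.306, p.309, Prop. 9 p.309] -/
theorem analyticOnNhd_chartH (h𝒪 : IsOpen 𝒪) (R : ∀ u ∈ 𝒪, Regime (𝒢 u) (Λ u) (W u) B₀ θ C₄ a₃ j a ε₄)
    (hJb : ∀ u ∈ 𝒪, ‖J u‖ ≤ j) (h𝔄b : ∀ u ∈ 𝒪, ‖𝔄 u‖ < a)
    (h𝒢 : AnalyticOnNhd ℂ 𝒢 𝒪) (hΛ : AnalyticOnNhd ℂ Λ 𝒪)
    (hW : AnalyticOnNhd ℂ (fun p : 𝒰 × 𝒴 => W p.1 p.2) (𝒪 ×ˢ {Y : 𝒴 | ‖Y‖ < a₃})) (hJ : AnalyticOnNhd ℂ J 𝒪)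
    (h𝔄 : AnalyticOnNhd ℂ 𝔄 𝒪) {Tm : 𝒰 → 𝒴 → 𝒴}
    (hTm : AnalyticOnNhd ℂ (fun p : 𝒰 × 𝒴 => Tm p.1 p.2) (𝒪 ×ˢ {Y : 𝒴 | ‖Y‖ < ε₄ + a})) :
    AnalyticOnNhd ℂ (fun u : 𝒰 => chartH (𝒢 u) (Λ u) (W u) (J u) (Tm u) ε₄ (𝔄 u)) 𝒪 := by
  intro u₀ hu₀
  have hsol := analyticAt_solA h𝒪 R hJb h𝔄b h𝒢 hΛ hW hJ h𝔄 hu₀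
  have harg : AnalyticAt ℂ (fun u : 𝒰 => solA (𝒢 u) (Λ u) (W u) (J u) ε₄ (𝔄 u) + 𝔄 u) u₀ := hsol.add (h𝔄 u₀ hu₀)
  have hin : AnalyticAt ℂ (fun u : 𝒰 => (u, solA (𝒢 u) (Λ u) (W u) (J u) ε₄ (𝔄 u) + 𝔄 u)) u₀ := analyticAt_id.prod harg
  have hmem : ‖solA (𝒢 u₀) (Λ u₀) (W u₀) (J u₀) ε₄ (𝔄 u₀) + 𝔄 u₀‖ < ε₄ + a :=
    norm_arg_lt (h𝔄b u₀ hu₀) ((R u₀ hu₀).solA_mem (hJb u₀ hu₀) (h𝔄b u₀ hu₀)).1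
  have hT : AnalyticAt ℂ (fun p : 𝒰 × 𝒴 => Tm p.1 p.2) (u₀, solA (𝒢 u₀) (Λ u₀) (W u₀) (J u₀) ε₄ (𝔄 u₀) + 𝔄 u₀) :=
    hTm _ ⟨hu₀, hmem⟩
  have h := AnalyticAt.comp_of_eq hT hin rfl
  simpa [Function.comp_def, chartH] using h

/-- **Proposition 9's clause «an analytic function of B, and also of the external gauge field configuration U»** — the two-parameter
reading: data depending on a pair `(U, B) ∈ 𝒪U ×ˢ 𝒪B` (e.g. `𝔄 (U, B) = H₁(U)B`, `𝔊 = 𝔊(U)`, `W = W(U, ·)`, `J = J(U)`) give a chart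
JOINTLY analytic in `(U, B)` — §3 over the product parameter space. [cite: Balaban1985Variational, Prop. 9 p.309] -/
theorem analyticOnNhd_chartH_pair {𝒰B : Type*} [NormedAddCommGroup 𝒰B] [NormedSpace ℂ 𝒰B] [CompleteSpace 𝒰B]
    {𝒪U : Set 𝒰} {𝒪B : Set 𝒰B} (h𝒪U : IsOpen 𝒪U) (h𝒪B : IsOpen 𝒪B)
    {𝒢₂ : 𝒰 × 𝒰B → (𝒵 →L[ℂ] 𝒴)} {Λ₂ : 𝒰 × 𝒰B → (𝒴 →L[ℂ] 𝒴)} {W₂ : 𝒰 × 𝒰B → 𝒴 → 𝒵} {J₂ : 𝒰 × 𝒰B → 𝒵}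
    {𝔄₂ : 𝒰 × 𝒰B → 𝒴} {Tm₂ : 𝒰 × 𝒰B → 𝒴 → 𝒴}
    (R : ∀ p ∈ 𝒪U ×ˢ 𝒪B, Regime (𝒢₂ p) (Λ₂ p) (W₂ p) B₀ θ C₄ a₃ j a ε₄)
    (hJb : ∀ p ∈ 𝒪U ×ˢ 𝒪B, ‖J₂ p‖ ≤ j) (h𝔄b : ∀ p ∈ 𝒪U ×ˢ 𝒪B, ‖𝔄₂ p‖ < a)
    (h𝒢 : AnalyticOnNhd ℂ 𝒢₂ (𝒪U ×ˢ 𝒪B)) (hΛ : AnalyticOnNhd ℂ Λ₂ (𝒪U ×ˢ 𝒪B))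
    (hW : AnalyticOnNhd ℂ (fun p : (𝒰 × 𝒰B) × 𝒴 => W₂ p.1 p.2) ((𝒪U ×ˢ 𝒪B) ×ˢ {Y : 𝒴 | ‖Y‖ < a₃}))
    (hJ : AnalyticOnNhd ℂ J₂ (𝒪U ×ˢ 𝒪B)) (h𝔄 : AnalyticOnNhd ℂ 𝔄₂ (𝒪U ×ˢ 𝒪B))
    (hTm : AnalyticOnNhd ℂ (fun p : (𝒰 × 𝒰B) × 𝒴 => Tm₂ p.1 p.2) ((𝒪U ×ˢ 𝒪B) ×ˢ {Y : 𝒴 | ‖Y‖ < ε₄ + a})) :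
    AnalyticOnNhd ℂ (fun p : 𝒰 × 𝒰B => chartH (𝒢₂ p) (Λ₂ p) (W₂ p) (J₂ p) (Tm₂ p) ε₄ (𝔄₂ p)) (𝒪U ×ˢ 𝒪B) :=
  analyticOnNhd_chartH (h𝒪U.prod h𝒪B) R hJb h𝔄b h𝒢 hΛ hW hJ h𝔄 hTm

end Scheme

end Literature.MathematicalPhysics.QuantumFieldTheory.Balaban1983to89.B11Claim309UAnalytic
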